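import Literature.Topology.FourManifolds.GaussDiagrams
import HarnessLib

/-!
# The connected sum of Gauss diagrams

Supplement to `Literature.Topology.FourManifolds.GaussDiagrams` (topic
`Literature/Topology/FourManifolds`): the **connected sum** `G # H` (`GaussDiagram.connSum G H`) of
two based Gauss diagrams — the Gauss diagram of the connected sum `D₁ # D₂` of two knot diagrams
performed at their base points, i.e. the *concatenation of the two Gauss words*: the `2 n₁` marked
points of `G` keep their positions `0, …, 2 n₁ - 1`, the `2 n₂` marked points of `H` are shifted to
`2 n₁, …, 2 n₁ + 2 n₂ - 1`, chords and signs are kept (chords of `G` first, `Fin.addCases`). On the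
knot diagrams this is the band sum along a short flat band joining the base arc of `D₁` (the arc
through its base point) to the base arc of `D₂`; it is the diagram "for `K₁ # K₂` shown in Figure 3"
from which Rasmussen (2010) proves the additivity `s(K₁ # K₂) = s(K₁) + s(K₂)` of his invariant
(Lemma 3.8, Prop. 3.11), and the first brick of the diagrammatic form of that additivity in this
library (the named fact `HasRasmussenInvariant.add` of `Rasmussen.lean`).

Contents (everything proved, no named fact):

* `GaussDiagram.inlPos`, `GaussDiagram.inrPos` — the two blocks of marked points of `G # H`, with
  their trichotomy `eq_inlPos_or_eq_inrPos`;
* `GaussDiagram.connSum` and its field lemmas (`connSum_n`, `connSum_overPos_castAdd`, …);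
* the writhe and the crossing counts are additive (`writhe_connSum`, `nPlus`/`nMinus` are in the
  `KhResolutions` layer and are treated in the sequel file), the mirror of a connected sum is the
  connected sum of the mirrors (`mirror_connSum`), and Gauss's parity condition (every chord has
  ends of opposite parity — the hypothesis under which the Khovanov/Lee theory of this library is
  developed, `KhResolutionsDichotomyProofs`, `GaussDiagramParity.AllEven`) passes to connected sums
  (`connSum_parity`, `connSum_parity_iff`).

## References

* J. Rasmussen, *Khovanov homology and the slice genus*, Invent. Math. 182 (2010) 419–447
  (arXiv:math/0402131), §3.1, Lemma 3.8, Fig. 3 and Prop. 3.11 (the diagram of `K₁ # K₂`).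
  [cite: Rasmussen2010, Lemma 3.8]
* M. Polyak, O. Viro, *Gauss diagram formulas for Vassiliev invariants*, IMRN 1994:11, §1 (based
  Gauss diagrams). [cite: IMRN1994, §1]
* S. Chmutov, S. Duzhin, J. Mostovoy, *Introduction to Vassiliev knot invariants*, CUP (2012),
  §1.4.1 (connected sum of knots), §1.7.2 (long knots: "the cut and paste procedure for the
  connected sum becomes a simple concatenation"), §1.7.3 (based Gauss diagrams, Def. 1.25), §13.3
  (connected sum of long Gauss diagrams). [cite: ChmutovDuzhinMostovoy2012, §1.7.2]
* D. Rolfsen, *Knots and Links* (1976), §2.G (connected sum). [cite: Rolfsen1976, §2.G]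

## Design notes

`connSum` depends on the base points of both diagrams (as the connected sum of knot diagrams
depends on the arcs chosen); changing them changes `G # H` by Reidemeister moves only, which is not
needed here. Positions of the two blocks are the plain `Fin.mk`s `⟨p, _⟩` and `⟨2 n₁ + q, _⟩`
(`inlPos`, `inrPos`), chords are indexed by `Fin (n₁ + n₂)` through `Fin.addCases`, so that all
field lemmas are `rfl`/`simp` and `(G # H).mirror = G.mirror # H.mirror` holds on the nose.
-/

open Function Set

namespace Literature.Topology.FourManifolds

namespace GaussDiagram

variable (G H : GaussDiagram)

/-! ## The two blocks of marked points -/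

/-- The marked point `p` of `G` as a marked point of `G # H` (same position). [folklore] -/
def inlPos (p : Fin (2 * G.n)) : Fin (2 * (G.n + H.n)) :=
  ⟨p, by omega⟩

/-- The marked point `q` of `H` as a marked point of `G # H` (position `2 n₁ + q`). [folklore] -/
def inrPos (q : Fin (2 * H.n)) : Fin (2 * (G.n + H.n)) :=
  ⟨2 * G.n + q, by omega⟩

/-- The position of a first-block point. [folklore] -/
@[simp] theorem inlPos_val (p : Fin (2 * G.n)) : (G.inlPos H p : ℕ) = p := rfl

/-- The position of a second-block point. [folklore] -/
@[simp] theorem inrPos_val (q : Fin (2 * H.n)) : (G.inrPos H q : ℕ) = 2 * G.n + q := rfl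

/-- `inlPos` is injective. [folklore] -/
theorem inlPos_injective : Injective (G.inlPos H) := fun p p' h ↦
  Fin.ext (by simpa using congrArg Fin.val h)

/-- `inrPos` is injective. [folklore] -/
theorem inrPos_injective : Injective (G.inrPos H) := fun q q' h ↦
  Fin.ext (by have := congrArg Fin.val h; simp at this; omega)

/-- `inlPos` is injective (`iff` form). [folklore] -/
@[simp] theorem inlPos_inj {p p' : Fin (2 * G.n)} : G.inlPos H p = G.inlPos H p' ↔ p = p' :=
  (G.inlPos_injective H).eq_iff

/-- `inrPos` is injective (`iff` form). [folklore] -/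
@[simp] theorem inrPos_inj {q q' : Fin (2 * H.n)} : G.inrPos H q = G.inrPos H q' ↔ q = q' :=
  (G.inrPos_injective H).eq_iff

/-- The two blocks are disjoint. [folklore] -/
theorem inlPos_ne_inrPos (p : Fin (2 * G.n)) (q : Fin (2 * H.n)) : G.inlPos H p ≠ G.inrPos H q := by
  intro h
  have := congrArg Fin.val h
  simp at this
  omega

/-- The two blocks are disjoint (symmetric form). [folklore] -/
theorem inrPos_ne_inlPos (q : Fin (2 * H.n)) (p : Fin (2 * G.n)) : G.inrPos H q ≠ G.inlPos H p :=
  fun h ↦ G.inlPos_ne_inrPos H p q h.symm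

/-- A marked point of `G # H` lies in the first block iff its position is `< 2 n₁`. [folklore] -/
theorem val_lt_iff_exists_inlPos (r : Fin (2 * (G.n + H.n))) :
    (r : ℕ) < 2 * G.n ↔ ∃ p, r = G.inlPos H p := by
  constructor
  · intro h
    exact ⟨⟨r, h⟩, rfl⟩
  · rintro ⟨p, rfl⟩
    exact p.isLt

/-- Every marked point of `G # H` lies in exactly one of the two blocks. [folklore] -/
theorem eq_inlPos_or_eq_inrPos (r : Fin (2 * (G.n + H.n))) :
    (∃ p, r = G.inlPos H p) ∨ ∃ q, r = G.inrPos H q := by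
  by_cases h : (r : ℕ) < 2 * G.n
  · exact Or.inl ⟨⟨r, h⟩, rfl⟩
  · refine Or.inr ⟨⟨r - 2 * G.n, by omega⟩, Fin.ext ?_⟩
    simp
    omega

/-- Block recursion for the marked points of `G # H`. [folklore] -/
theorem pos_cases {motive : Fin (2 * (G.n + H.n)) → Prop} (inl : ∀ p, motive (G.inlPos H p))
    (inr : ∀ q, motive (G.inrPos H q)) (r : Fin (2 * (G.n + H.n))) : motive r := by
  rcases G.eq_inlPos_or_eq_inrPos H r with ⟨p, rfl⟩ | ⟨q, rfl⟩
  exacts [inl p, inr q]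

/-! ## The connected sum -/

/-- The **connected sum** `G # H` of two based Gauss diagrams: the concatenation of the two Gauss
words. It has `n₁ + n₂` chords; chord `Fin.castAdd n₂ i` is chord `i` of `G` with both ends at
their old positions (`inlPos`), chord `Fin.natAdd n₁ j` is chord `j` of `H` with both ends shifted
by `2 n₁` (`inrPos`); signs are kept. This is the Gauss diagram of the connected sum of two knot
diagrams banded together along their base arcs. Rasmussen (2010), Fig. 3 (the diagram of
`K₁ # K₂`); Chmutov–Duzhin–Mostovoy (2012), §1.7.2–1.7.3 (cutting at the base points turns the knots
into long knots, whose connected sum is concatenation), §13.3. [cite: Rasmussen2010, Lemma 3.8] -/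
def connSum : GaussDiagram where
  n := G.n + H.n
  overPos := Fin.addCases (fun i ↦ G.inlPos H (G.overPos i)) (fun j ↦ G.inrPos H (H.overPos j))
  underPos := Fin.addCases (fun i ↦ G.inlPos H (G.underPos i)) (fun j ↦ G.inrPos H (H.underPos j))
  sign := Fin.addCases G.sign H.sign
  bijective := by
    classical
    refine (Fintype.bijective_iff_surjective_and_card _).2 ⟨?_, by simp; omega⟩
    intro r
    rcases G.eq_inlPos_or_eq_inrPos H r with ⟨p, rfl⟩ | ⟨q, rfl⟩
    · obtain ⟨x, hx⟩ := G.bijective.surjective p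
      rcases x with i | i
      · exact ⟨Sum.inl (Fin.castAdd H.n i), by simp [← hx]⟩
      · exact ⟨Sum.inr (Fin.castAdd H.n i), by simp [← hx]⟩
    · obtain ⟨x, hx⟩ := H.bijective.surjective q
      rcases x with j | j
      · exact ⟨Sum.inl (Fin.natAdd G.n j), by simp [← hx]⟩
      · exact ⟨Sum.inr (Fin.natAdd G.n j), by simp [← hx]⟩

/-- `G # H` has `n₁ + n₂` chords. [folklore] -/
@[simp] theorem connSum_n : (G.connSum H).n = G.n + H.n := rfl

/-- Chords of the first block keep their over-passages. [folklore] -/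
@[simp] theorem connSum_overPos_castAdd (i : Fin G.n) :
    (G.connSum H).overPos (Fin.castAdd H.n i) = G.inlPos H (G.overPos i) := by
  simp [connSum]

/-- Chords of the first block keep their under-passages. [folklore] -/
@[simp] theorem connSum_underPos_castAdd (i : Fin G.n) :
    (G.connSum H).underPos (Fin.castAdd H.n i) = G.inlPos H (G.underPos i) := by
  simp [connSum]

/-- Chords of the first block keep their signs. [folklore] -/
@[simp] theorem connSum_sign_castAdd (i : Fin G.n) :
    (G.connSum H).sign (Fin.castAdd H.n i) = G.sign i := by
  simp [connSum]

/-- Chords of the second block have their over-passages shifted by `2 n₁`. [folklore] -/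
@[simp] theorem connSum_overPos_natAdd (j : Fin H.n) :
    (G.connSum H).overPos (Fin.natAdd G.n j) = G.inrPos H (H.overPos j) := by
  simp [connSum]

/-- Chords of the second block have their under-passages shifted by `2 n₁`. [folklore] -/
@[simp] theorem connSum_underPos_natAdd (j : Fin H.n) :
    (G.connSum H).underPos (Fin.natAdd G.n j) = G.inrPos H (H.underPos j) := by
  simp [connSum]

/-- Chords of the second block keep their signs. [folklore] -/
@[simp] theorem connSum_sign_natAdd (j : Fin H.n) :
    (G.connSum H).sign (Fin.natAdd G.n j) = H.sign j := by
  simp [connSum]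

/-- Block recursion for the chords of `G # H` (`Fin.addCases`). [folklore] -/
theorem chord_cases {motive : Fin (G.connSum H).n → Prop} (left : ∀ i : Fin G.n, motive (Fin.castAdd H.n i))
    (right : ∀ j : Fin H.n, motive (Fin.natAdd G.n j)) (k : Fin (G.connSum H).n) : motive k :=
  Fin.addCases left right k

/-- The ends of a chord of the first block lie in the first block, those of a chord of the second
block in the second block: positions of over-passages. [folklore] -/
theorem connSum_overPos_val_lt_iff (k : Fin (G.connSum H).n) :
    ((G.connSum H).overPos k : ℕ) < 2 * G.n ↔ (k : ℕ) < G.n := by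
  induction k using Fin.addCases with
  | left i => simp [i.isLt, (G.overPos i).isLt]
  | right j => simp

/-- Same for under-passages. [folklore] -/
theorem connSum_underPos_val_lt_iff (k : Fin (G.connSum H).n) :
    ((G.connSum H).underPos k : ℕ) < 2 * G.n ↔ (k : ℕ) < G.n := by
  induction k using Fin.addCases with
  | left i => simp [i.isLt, (G.underPos i).isLt]
  | right j => simp

/-! ## Writhe, mirror image, parity -/

/-- **The writhe is additive** under connected sum (signs are kept). Kauffman (1987), Ch. II.
[cite: Kauffman1987, Ch. II] -/
@[simp] theorem writhe_connSum : (G.connSum H).writhe = G.writhe + H.writhe := by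
  unfold writhe
  change ∑ k : Fin (G.n + H.n), (((G.connSum H).sign k : ℤˣ) : ℤ) = _
  rw [Fin.sum_univ_add]
  simp

/-- Negation commutes with `Fin.addCases` (signs of the two blocks). [folklore] -/
theorem neg_addCases {m n : ℕ} (f : Fin m → ℤˣ) (g : Fin n → ℤˣ) :
    -(Fin.addCases (motive := fun _ ↦ ℤˣ) f g : Fin (m + n) → ℤˣ) =
      Fin.addCases (motive := fun _ ↦ ℤˣ) (-f) (-g) := by
  funext k
  induction k using Fin.addCases with
  | left i => simp
  | right j => simp

/-- **The mirror image of a connected sum is the connected sum of the mirror images** (on the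
nose: over- and under-passages are swapped and signs negated blockwise). Rolfsen (1976), §3.C;
Rasmussen (2010), proof of Prop. 3.11 ("applying the same argument to `K̄₁` and `K̄₂`").
[cite: Rasmussen2010, Prop. 3.11] -/
theorem mirror_connSum : (G.connSum H).mirror = G.mirror.connSum H.mirror := by
  simp only [mirror, connSum, GaussDiagram.mk.injEq, heq_eq_eq, true_and]
  exact ⟨rfl, rfl, neg_addCases G.sign H.sign⟩

/-- The connected sum with the empty diagram on the right is the diagram itself. [folklore] -/
theorem connSum_empty : G.connSum GaussDiagram.empty = G := by
  obtain ⟨n, ov, un, sg, bij⟩ := G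
  simp only [connSum, GaussDiagram.mk.injEq, GaussDiagram.empty, Nat.add_zero, heq_eq_eq, true_and]
  refine ⟨?_, ?_, ?_⟩
  · funext k
    change Fin.addCases (motive := fun _ ↦ Fin (2 * (n + 0))) _ _ (Fin.castAdd 0 k) = _
    rw [Fin.addCases_left]
    exact Fin.ext rfl
  · funext k
    change Fin.addCases (motive := fun _ ↦ Fin (2 * (n + 0))) _ _ (Fin.castAdd 0 k) = _
    rw [Fin.addCases_left]
    exact Fin.ext rfl
  · funext k
    change Fin.addCases (motive := fun _ ↦ ℤˣ) _ _ (Fin.castAdd 0 k) = _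
    rw [Fin.addCases_left]

/-- **Gauss's parity condition passes to connected sums**: if every chord of `G` and of `H` has
ends at positions of opposite parity, so does every chord of `G # H` (the shift `2 n₁` of the
second block is even). This is the hypothesis under which the cube of resolutions of a Gauss
diagram has the merge/split dichotomy (`KhResolutionsDichotomyProofs`), and it is the predicate
`GaussDiagram.AllEven` of `GaussDiagramParity` unfolded. Kauffman (1999), §3.2 (evenly
intersticed Gauss codes). [cite: Kauffman1999, §3.2] -/
theorem connSum_parity (hG : ∀ i : Fin G.n, (G.overPos i : ℕ) % 2 ≠ (G.underPos i : ℕ) % 2)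
    (hH : ∀ j : Fin H.n, (H.overPos j : ℕ) % 2 ≠ (H.underPos j : ℕ) % 2)
    (k : Fin (G.connSum H).n) :
    ((G.connSum H).overPos k : ℕ) % 2 ≠ ((G.connSum H).underPos k : ℕ) % 2 := by
  induction k using Fin.addCases with
  | left i => simpa using hG i
  | right j =>
    have := hH j
    simp only [connSum_overPos_natAdd, connSum_underPos_natAdd, inrPos_val]
    omega

/-- Conversely the parity condition for `G # H` gives it for both summands. [folklore] -/
theorem connSum_parity_iff :
    (∀ k : Fin (G.connSum H).n, ((G.connSum H).overPos k : ℕ) % 2 ≠ ((G.connSum H).underPos k : ℕ) % 2) ↔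
      (∀ i : Fin G.n, (G.overPos i : ℕ) % 2 ≠ (G.underPos i : ℕ) % 2) ∧
        ∀ j : Fin H.n, (H.overPos j : ℕ) % 2 ≠ (H.underPos j : ℕ) % 2 := by
  constructor
  · intro h
    refine ⟨fun i ↦ ?_, fun j ↦ ?_⟩
    · simpa using h (Fin.castAdd H.n i)
    · have := h (Fin.natAdd G.n j)
      simp only [connSum_overPos_natAdd, connSum_underPos_natAdd, inrPos_val] at this
      omega
  · rintro ⟨hG, hH⟩
    exact G.connSum_parity H hG hH

end GaussDiagram

end Literature.Topology.FourManifolds
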